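import Mathlib.NumberTheory.DirichletCharacter.Bounds
import Mathlib.Analysis.SpecialFunctions.Complex.Circle
import HarnessLib

/-!
# rh-explicit (venture WeilGRH): «(−4/·) HAS THE THIRD-HIGHEST LOWEST ZERO» — elementary glue: characters mod `9, 11, 13, 15, 17`,
  fourth and fifth roots of unity, `χ(2) = 0` for every even modulus (weil-3 gen20)

Cell `rh-explicit`, WEIL TRACK (structure seat weil-3, gen20).  Pure Mathlib facts, no analysis of `L`-functions, continuing
`ChampionRoots` / `RunnerUpRoots` (gen19) for the third rung of the «highest lowest zero» ladder, whose even arc certificates only start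
at conductor `19`, so that the even characters of conductor `9 … 17` must be dispatched through the exact value of `χ(2)`:
* `eq_one_of_chi_two_eq_one_mod9` (`2` generates the units mod `9`);
* `chi_neg_one_mod11` (`χ(−1) = χ(2)⁵`), `chi_neg_one_mod13` (`χ(−1) = χ(2)⁶`), `pow_chi_two_mod15` (`χ(2)⁴ = 1`),
  `chi_neg_one_mod17` (`χ(−1) = χ(2)⁴`);
* `pow_four_eq_one_cases` (`z⁴ = 1 ⇒ z ∈ {1, −1}` or `z ∈ {i, −i}`);
* ★ `boxes_of_pow_five_eq_one`: `z⁵ = 1 ⇒ z = 1` or `(Re z, Im z)` lies in one of the four boxes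
  `[0.3090, 0.3091] × ±[0.9510, 0.9511]`, `[−0.8091, −0.8090] × ±[0.5877, 0.5878]` (the primitive fifth roots of unity:
  `4x² + 2x − 1 = 0` from `z² + z + 1 + z̄ + z̄² = 0`);
* `pow_three_eq_one_of_re_eq_neg_half` / `pow_three_eq_neg_one_of_re_eq_half` (`Re z = ∓½`, `(Im z)² = ¾ ⇒ z³ = ±1`: parity decides
  which sixth roots occur), `im_mem_box_of_four_mul_sq_eq_three` (`4y² = 3 ⇒ y ∈ ±[0.866, 0.8661]`);
* `chi_two_eq_zero_of_even` (`q` even ⇒ `χ(2) = 0`).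
RH/GRH-free; no definitions; standard axioms; nothing here bears on the truth of RH or GRH.
-/

set_option autoImplicit false

namespace Summit.Ventures.WeilGRH.Christoffel

open Complex

/-! ## Modulus `9`: `2` generates the units -/

/-- The units mod `9` as powers of `2`. -/
theorem zmod9_unit_cases : ∀ x : ZMod 9, IsUnit x →
    x = 1 ∨ x = 2 ∨ x = 2 * 2 ∨ x = 2 * 2 * 2 ∨ x = 2 * 2 * 2 * 2 ∨ x = 2 * 2 * 2 * 2 * 2 := by decide

/-- **A character mod `9` with `χ(2) = 1` is trivial** (`2` generates the units mod `9`). -/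
theorem eq_one_of_chi_two_eq_one_mod9 (χ : DirichletCharacter ℂ 9) (h2 : χ (2 : ZMod 9) = 1) : χ = 1 := by
  apply MulChar.ext'
  intro x
  by_cases hx : IsUnit x
  · rw [MulChar.one_apply hx]
    rcases zmod9_unit_cases x hx with rfl | rfl | rfl | rfl | rfl | rfl
    · exact map_one χ
    · exact h2
    all_goals simp only [map_mul, h2, mul_one]
  · rw [χ.map_nonunit hx, MulChar.map_nonunit _ hx]

/-! ## Moduli `11, 13, 15, 17`: `χ(−1)` and `χ(2)⁴` as powers of `χ(2)` -/

/-- mod `11`: `χ(−1) = χ(2)⁵` (`2⁵ = 32 ≡ −1`). -/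
theorem chi_neg_one_mod11 (χ : DirichletCharacter ℂ 11) : χ (-1) = χ (2 : ZMod 11) ^ 5 := by
  rw [← map_pow, show ((2 : ZMod 11) ^ 5) = -1 by decide]

/-- mod `13`: `χ(−1) = χ(2)⁶` (`2⁶ = 64 ≡ −1`). -/
theorem chi_neg_one_mod13 (χ : DirichletCharacter ℂ 13) : χ (-1) = χ (2 : ZMod 13) ^ 6 := by
  rw [← map_pow, show ((2 : ZMod 13) ^ 6) = -1 by decide]

/-- mod `15`: `χ(2)⁴ = 1` (`2⁴ = 16 ≡ 1`). -/
theorem pow_chi_two_mod15 (χ : DirichletCharacter ℂ 15) : χ (2 : ZMod 15) ^ 4 = 1 := by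
  rw [← map_pow, show ((2 : ZMod 15) ^ 4) = 1 by decide, map_one]

/-- mod `17`: `χ(−1) = χ(2)⁴` (`2⁴ = 16 ≡ −1`). -/
theorem chi_neg_one_mod17 (χ : DirichletCharacter ℂ 17) : χ (-1) = χ (2 : ZMod 17) ^ 4 := by
  rw [← map_pow, show ((2 : ZMod 17) ^ 4) = -1 by decide]

/-! ## Fourth roots of unity -/

/-- `z⁴ = 1 ⇒ z ∈ {1, −1}` (`z² = 1`) or `z ∈ {i, −i}` (`z² = −1`). -/
theorem pow_four_eq_one_cases {z : ℂ} (hz : z ^ 4 = 1) : (z = 1 ∨ z = -1) ∨ (z = I ∨ z = -I) := by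
  have h : (z ^ 2 - 1) * (z ^ 2 + 1) = 0 := by linear_combination hz
  rcases mul_eq_zero.1 h with h1 | h1
  · have : z ^ 2 = 1 := by linear_combination h1
    exact Or.inl (sq_eq_one_iff.1 this)
  · have h3 : (z - I) * (z + I) = 0 := by
      have e : (z - I) * (z + I) = z ^ 2 - I ^ 2 := by ring
      rw [e, Complex.I_sq]; linear_combination h1
    rcases mul_eq_zero.1 h3 with h4 | h4
    · exact Or.inr (Or.inl (by linear_combination h4))
    · exact Or.inr (Or.inr (by linear_combination h4))

/-! ## Fifth roots of unity -/

/-- `z⁵ = 1 ⇒ z = 1` or (`4 (Re z)² + 2 Re z − 1 = 0` and `(Re z)² + (Im z)² = 1`): for a primitive fifth root of unity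
`s = z + z⁻¹ = z + z̄ = 2 Re z` satisfies `s² + s − 1 = 0`. -/
theorem re_of_pow_five_eq_one {z : ℂ} (hz : z ^ 5 = 1) :
    z = 1 ∨ (4 * z.re ^ 2 + 2 * z.re - 1 = 0 ∧ z.re ^ 2 + z.im ^ 2 = 1) := by
  by_cases h1 : z = 1
  · exact Or.inl h1
  right
  have hnorm : ‖z‖ = 1 := by
    have h := congrArg norm hz
    rw [norm_pow, norm_one] at h
    exact (pow_eq_one_iff_of_nonneg (norm_nonneg z) (by norm_num)).1 h
  have hsq : z.re ^ 2 + z.im ^ 2 = 1 := by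
    have h2 : ‖z‖ ^ 2 = 1 := by rw [hnorm]; norm_num
    rw [Complex.sq_norm, Complex.normSq_apply] at h2
    nlinarith [h2]
  refine ⟨?_, hsq⟩
  have hz0 : z ≠ 0 := fun h ↦ by rw [h] at hnorm; simp at hnorm
  have hw : z ^ 4 + z ^ 3 + z ^ 2 + z + 1 = 0 := by
    have hf : (z - 1) * (z ^ 4 + z ^ 3 + z ^ 2 + z + 1) = 0 := by linear_combination hz
    rcases mul_eq_zero.1 hf with h | h
    · exact absurd (by linear_combination h : z = 1) h1
    · exact h
  -- `z̄ z = 1`, so `z + z̄ = 2 Re z` and `z̄² (z⁴ + z³ + z² + z + 1) = z² + z + 1 + z̄ + z̄²`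
  have hconj : (starRingEnd ℂ) z * z = 1 := by
    rw [← Complex.normSq_eq_conj_mul_self, Complex.normSq_eq_norm_sq, hnorm]; norm_num
  have hs : (z + (starRingEnd ℂ) z) = ((2 * z.re : ℝ) : ℂ) := Complex.add_conj z
  have hw2 : z ^ 2 + z + 1 + (starRingEnd ℂ) z + (starRingEnd ℂ) z ^ 2 = 0 := by
    linear_combination (starRingEnd ℂ) z ^ 2 * hw - (((starRingEnd ℂ) z * z + 1) * (z ^ 2 + z + 1) + (starRingEnd ℂ) z) * hconj
  have hpoly : ((2 * z.re : ℝ) : ℂ) ^ 2 + ((2 * z.re : ℝ) : ℂ) - 1 = 0 := by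
    rw [← hs]
    linear_combination hw2 + 2 * hconj
  have hre : (((2 * z.re) ^ 2 + 2 * z.re - 1 : ℝ) : ℂ) = 0 := by push_cast at hpoly ⊢; exact hpoly
  have hre' := Complex.ofReal_eq_zero.1 hre
  linarith [hre']

/-- `4x² + 2x − 1 = 0 ⇒ x ∈ [0.30901, 0.30902]` or `x ∈ [−0.80902, −0.80901]` (the roots `(−1 ± √5)/4`). -/
theorem root_boxes_of_quadratic {x : ℝ} (h : 4 * x ^ 2 + 2 * x - 1 = 0) :
    ((0.30901 : ℝ) ≤ x ∧ x ≤ (0.30902 : ℝ)) ∨ (((-0.80902 : ℝ)) ≤ x ∧ x ≤ ((-0.80901 : ℝ))) := by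
  rcases le_or_gt (-1 / 4 : ℝ) x with hx | hx
  · left
    constructor
    · by_contra hc
      have hc' := not_le.1 hc
      nlinarith [mul_pos (sub_pos.2 hc') (by linarith : (0 : ℝ) < 4 * x + 4 * 0.30901 + 2)]
    · by_contra hc
      have hc' := not_le.1 hc
      nlinarith [mul_pos (sub_pos.2 hc') (by linarith : (0 : ℝ) < 4 * x + 4 * 0.30902 + 2)]
  · right
    constructor
    · by_contra hc
      have hc' := not_le.1 hc
      nlinarith [mul_pos (sub_pos.2 hc') (by linarith : (0 : ℝ) < -(4 * x + 4 * (-0.80902) + 2))]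
    · by_contra hc
      have hc' := not_le.1 hc
      nlinarith [mul_pos (sub_pos.2 hc') (by linarith : (0 : ℝ) < -(4 * x + 4 * (-0.80901) + 2))]

/-- ★ **The primitive fifth roots of unity in boxes**: `z⁵ = 1 ⇒ z = 1`, or `(Re z, Im z)` lies in `[0.3090, 0.3091] × [0.9510, 0.9511]`,
`[0.3090, 0.3091] × [−0.9511, −0.9510]`, `[−0.8091, −0.8090] × [0.5877, 0.5878]` or `[−0.8091, −0.8090] × [−0.5878, −0.5877]` — the value boxes
of the conductor-`11` even certificates of the third rung. -/
theorem boxes_of_pow_five_eq_one {z : ℂ} (hz : z ^ 5 = 1) :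
    z = 1 ∨
    (((0.309 : ℝ) ≤ z.re ∧ z.re ≤ (0.3091 : ℝ)) ∧ ((0.951 : ℝ) ≤ z.im ∧ z.im ≤ (0.9511 : ℝ))) ∨
    (((0.309 : ℝ) ≤ z.re ∧ z.re ≤ (0.3091 : ℝ)) ∧ (((-0.9511 : ℝ)) ≤ z.im ∧ z.im ≤ ((-0.951 : ℝ)))) ∨
    ((((-0.8091 : ℝ)) ≤ z.re ∧ z.re ≤ ((-0.809 : ℝ))) ∧ ((0.5877 : ℝ) ≤ z.im ∧ z.im ≤ (0.5878 : ℝ))) ∨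
    ((((-0.8091 : ℝ)) ≤ z.re ∧ z.re ≤ ((-0.809 : ℝ))) ∧ (((-0.5878 : ℝ)) ≤ z.im ∧ z.im ≤ ((-0.5877 : ℝ)))) := by
  rcases re_of_pow_five_eq_one hz with h | ⟨hq, hsq⟩
  · exact Or.inl h
  right
  set x := z.re
  set y := z.im
  rcases root_boxes_of_quadratic hq with ⟨hx0, hx1⟩ | ⟨hx0, hx1⟩
  · have hy2lo : (0.9045066 : ℝ) ≤ y ^ 2 := by nlinarith
    have hy2hi : y ^ 2 ≤ (0.9045129 : ℝ) := by nlinarith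
    rcases le_or_gt 0 y with hy | hy
    · left
      refine ⟨⟨by linarith, by linarith⟩, ?_, ?_⟩
      · nlinarith [sq_nonneg (y + 0.9510)]
      · nlinarith [sq_nonneg (y + 0.9511)]
    · right; left
      refine ⟨⟨by linarith, by linarith⟩, ?_, ?_⟩
      · nlinarith [sq_nonneg (y - 0.9511)]
      · nlinarith [sq_nonneg (y - 0.9510)]
  · have hy2lo : (0.3454866 : ℝ) ≤ y ^ 2 := by nlinarith
    have hy2hi : y ^ 2 ≤ (0.3455029 : ℝ) := by nlinarith
    rcases le_or_gt 0 y with hy | hy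
    · right; right; left
      refine ⟨⟨by linarith, by linarith⟩, ?_, ?_⟩
      · nlinarith [sq_nonneg (y + 0.5877)]
      · nlinarith [sq_nonneg (y + 0.5878)]
    · right; right; right
      refine ⟨⟨by linarith, by linarith⟩, ?_, ?_⟩
      · nlinarith [sq_nonneg (y - 0.5878)]
      · nlinarith [sq_nonneg (y - 0.5877)]


/-! ## Cube roots on the unit circle: the sign of `z³` from `Re z` -/

/-- `Re z = −½`, `(Im z)² = ¾` ⇒ `z³ = 1` (the primitive cube roots of unity). -/
theorem pow_three_eq_one_of_re_eq_neg_half {z : ℂ} (hre : z.re = -1 / 2) (him : z.im ^ 2 = 3 / 4) : z ^ 3 = 1 := by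
  apply Complex.ext
  · have e : (z ^ 3).re = z.re ^ 3 - 3 * z.re * z.im ^ 2 := by simp [pow_succ, Complex.mul_re, Complex.mul_im]; ring
    rw [e, hre, him]; norm_num
  · have e : (z ^ 3).im = 3 * z.re ^ 2 * z.im - z.im * z.im ^ 2 := by simp [pow_succ, Complex.mul_re, Complex.mul_im]; ring
    rw [e, hre, him]; simp only [Complex.one_im]; ring

/-- `Re z = ½`, `(Im z)² = ¾` ⇒ `z³ = −1` (the primitive sixth roots of unity). -/
theorem pow_three_eq_neg_one_of_re_eq_half {z : ℂ} (hre : z.re = 1 / 2) (him : z.im ^ 2 = 3 / 4) : z ^ 3 = -1 := by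
  apply Complex.ext
  · have e : (z ^ 3).re = z.re ^ 3 - 3 * z.re * z.im ^ 2 := by simp [pow_succ, Complex.mul_re, Complex.mul_im]; ring
    rw [e, hre, him]; norm_num
  · have e : (z ^ 3).im = 3 * z.re ^ 2 * z.im - z.im * z.im ^ 2 := by simp [pow_succ, Complex.mul_re, Complex.mul_im]; ring
    rw [e, hre, him]; simp only [Complex.neg_im, Complex.one_im]; ring

/-- `4y² = 3 ⇒ y ∈ [0.866, 0.8661]` or `y ∈ [−0.8661, −0.866]` (the `Im`-boxes of the exact-value certificates at the cube / sixth roots of unity). -/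
theorem im_mem_box_of_four_mul_sq_eq_three {y : ℝ} (h : 4 * y ^ 2 = 3) :
    ((0.866 : ℝ) ≤ y ∧ y ≤ (0.8661 : ℝ)) ∨ (((-0.8661 : ℝ)) ≤ y ∧ y ≤ ((-0.866 : ℝ))) := by
  rcases le_or_gt 0 y with hy | hy
  · left
    constructor
    · nlinarith [sq_nonneg (y - 0.866), sq_nonneg (y + 0.866)]
    · nlinarith [sq_nonneg (y - 0.8661), sq_nonneg (y + 0.8661)]
  · right
    constructor
    · nlinarith [sq_nonneg (y - 0.8661), sq_nonneg (y + 0.8661)]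
    · nlinarith [sq_nonneg (y - 0.866), sq_nonneg (y + 0.866)]

/-! ## Even moduli -/

/-- For an even modulus, `χ(2) = 0`. -/
theorem chi_two_eq_zero_of_even {q : ℕ} (hq : Even q) (χ : DirichletCharacter ℂ q) : χ (2 : ZMod q) = 0 := by
  apply χ.map_nonunit
  intro hu
  have h2 : (2 : ZMod q) = ((2 : ℕ) : ZMod q) := by norm_cast
  rw [h2, ZMod.isUnit_iff_coprime] at hu
  have := Nat.Coprime.eq_one_of_dvd hu (even_iff_two_dvd.1 hq)
  omega

end Summit.Ventures.WeilGRH.Christoffel
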